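import Literature.Barriers.CriticalPhenomena.GridSAWFormulaStamps
import HarnessLib

/-!
# The grid drawing of the graph of a formula, III: the decided finite checks on the stamps

The finite part of the validity proof of the grid drawing `E₀` of the graph of a formula
(`GridSAWFormulaDrawing.lean`; Liśkiewicz–Ogihara–Toda 2003, proof of Theorem 7): Boolean checks on
the generated tables of `GridSAWFormulaStamps.lean`, evaluated by the kernel (`decide +kernel`; the pair compatibility check `compat_all` is decided per kind in the two sibling files `GridSAWFormulaStampCompatA.lean`, `GridSAWFormulaStampCompatB.lean`):

* `Kind.edgesWF` / `edgesWF_all` — every edge of every kind is well formed (ends listed and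
  distinct, the rectilinear path through its corners runs between their positions, is
  self-avoiding, a grid path);
* `Kind.localOK` / `localOK_all` — within a kind: distinct positions, positions meet edges only at
  their ends, distinct edges meet only at common ends and never repeat an end pair;
* `mayCooccur` — the realisability filter on a pair of kinds at a tile offset (row classes,
  tile-kind classes, one cell per position, one chord per family, landing slots, row-chord flags,
  declared sources of column cables, OR-gadget heads), whose soundness for the actual drawing is
  proved in `GridSAWFormulaDrawing.lean`;
* `Kind.compatB` / `compat_all` and `Kind.phantomOKB` / `phantomOK_all` — for every realisable pair
  at every near offset (`|Δi| ≤ 1`, `|Δj| ≤ 2`): the congestion conditions between the two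
  translated kinds, and agreement of the foreign end points of one with the vertices of the other.

The Python model of these very checks (same tables, same offsets) passes; here the kernel confirms
them.

## References

* M. Liśkiewicz, M. Ogihara, S. Toda, TCS 304 (2003) 129–156, §4 (proof of Theorem 7, `E₀`: "the
  paths which realize the edges … are vertex disjoint").
-/

namespace Literature.Barriers.CriticalPhenomena.GridSAW.FormulaDrawing

/-! ### Items and the pairwise congestion tests -/

/-- Consecutive corner pairs of a corner list. [folklore] -/
def csegs (ws : List GridPoint) : List (GridPoint × GridPoint) := ws.zip (ws.drop 1)

/-- The two end points of a corner list (head and last). [folklore] -/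
def endsOf (ws : List GridPoint) : List GridPoint := ws.head?.toList ++ ws.getLast?.toList

/-- Bounding box `(x₀, x₁, y₀, y₁)` of a nonempty point list (junk on `[]`). [folklore] -/
def bboxOf (l : List GridPoint) : ℤ × ℤ × ℤ × ℤ :=
  l.foldl (fun b p => (min b.1 p.1, max b.2.1 p.1, min b.2.2.1 p.2, max b.2.2.2 p.2))
    ((l.headD (0, 0)).1, (l.headD (0, 0)).1, (l.headD (0, 0)).2, (l.headD (0, 0)).2)

/-- Two boxes, the second translated by `δ`, are disjoint. [folklore] -/
def boxApartB (b₁ b₂ : ℤ × ℤ × ℤ × ℤ) (δ : GridPoint) : Bool :=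
  decide (b₁.2.1 < b₂.1 + δ.1) || decide (b₂.2.1 + δ.1 < b₁.1) ||
    decide (b₁.2.2.2 < b₂.2.2.1 + δ.2) || decide (b₂.2.2.2 + δ.2 < b₁.2.2.1)

/-- **Edge against edge**: every common point of the two corner paths (the second translated by `δ`)
is a common end point. [folklore] -/
def edgeEdgeB (ws₁ ws₂ : List GridPoint) (δ : GridPoint) : Bool :=
  boxApartB (bboxOf ws₁) (bboxOf ws₂) δ ||
  (let E := (endsOf ws₁).filter fun p => ((endsOf ws₂).map (shiftPt δ)).contains p
   (csegs ws₁).all fun s => (csegs ws₂).all fun t => csegMeetB s.1 s.2 (shiftPt δ t.1) (shiftPt δ t.2) E)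

/-- **Point against edge**: if the point lies on the corner path (translated by `δ`) then it is one
of its end points. [folklore] -/
def ptEdgeB (p : GridPoint) (ws : List GridPoint) (δ : GridPoint) : Bool :=
  boxApartB (p.1, p.1, p.2, p.2) (bboxOf ws) δ ||
  (csegs ws).all fun t => csegMeetB p p (shiftPt δ t.1) (shiftPt δ t.2) ((endsOf ws).map (shiftPt δ))

namespace Kind

/-- The edges of a kind with their full rectilinear paths. [folklore] -/
def edges (κ : Kind) : List (Ref × Ref × List GridPoint) := (wedges κ).map fun e => (e.1, e.2.1, poly e.2.2)

/-- Own and foreign vertices with local positions. [folklore] -/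
def posTable (κ : Kind) : List (Ref × GridPoint) := verts κ ++ phantoms κ

/-- The local position of a reference. [folklore] -/
def lpos (κ : Kind) (r : Ref) : GridPoint := ((posTable κ).lookup r).getD (0, 0)

/-- Bounding box of everything of a kind (listed positions and path corners). [folklore] -/
def bbox (κ : Kind) : ℤ × ℤ × ℤ × ℤ :=
  bboxOf ((posTable κ).map Prod.snd ++ (wedges κ).flatMap fun e => e.2.2)

/-- **Single-edge well-formedness** of the edges of a kind. [folklore] -/
def edgesWF (κ : Kind) : Bool :=
  (wedges κ).all fun e =>
    ((posTable κ).map Prod.fst).contains e.1 && ((posTable κ).map Prod.fst).contains e.2.1 && decide (e.1 ≠ e.2.1) &&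
    decide ((poly e.2.2).head? = some (lpos κ e.1)) && decide ((poly e.2.2).getLast? = some (lpos κ e.2.1)) &&
    decide (e.2.2.head? = some (lpos κ e.1)) && decide (e.2.2.getLast? = some (lpos κ e.2.1)) &&
    decide ((poly e.2.2).Nodup) && decide (List.IsChain IsGridEdge (poly e.2.2)) && decide (2 ≤ e.2.2.length)

/-- **Local congestion check** of a kind. [folklore] -/
def localOK (κ : Kind) : Bool :=
  let T := posTable κ
  let W := wedges κ
  (T.all fun a => T.all fun b => decide (a.2 = b.2 → a.1 = b.1)) &&
  (T.all fun a => W.all fun e => ptEdgeB a.2 e.2.2 (0, 0)) &&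
  (W.all fun e => W.all fun e' => decide (e = e') || (edgeEdgeB e.2.2 e'.2.2 (0, 0) &&
    !(decide (e.1 = e'.1) && decide (e.2.1 = e'.2.1)) && !(decide (e.1 = e'.2.1) && decide (e.2.1 = e'.1))))

/-- Re-anchoring a reference of an object at tile offset `Δ` to the frame of the object at offset
`0`. [folklore] -/
def reRef (Δ : ℤ × ℤ) : Ref → Ref
  | .cell di dj c l => .cell (di + Δ.1) (dj + Δ.2) c l
  | .gad di dj f idx => .gad (di + Δ.1) (dj + Δ.2) f idx

/-- The translation vector of a tile offset `Δ = (Δi, Δj)` (rows of pitch `160` downwards, columns of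
pitch `117` eastwards). [folklore] -/
def shiftOf (Δ : ℤ × ℤ) : GridPoint := (117 * Δ.2, -160 * Δ.1)

/-- **Compatibility of two kinds at tile offset `Δ`** (the second anchored `Δ` tiles away from the
first): own vertex positions differ, listed positions meet the other's edges only at their ends,
edges meet only at common ends and no end pair repeats (at the level of re-anchored references).
Far-apart bounding boxes pass at once. [folklore] -/
def compatB (κ₁ κ₂ : Kind) (Δ : ℤ × ℤ) : Bool :=
  let δ := shiftOf Δ
  boxApartB (bbox κ₁) (bbox κ₂) δ ||
  (((verts κ₁).all fun a => (verts κ₂).all fun b => decide (a.2 ≠ shiftPt δ b.2)) &&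
   ((posTable κ₁).all fun a => (wedges κ₂).all fun e => ptEdgeB a.2 e.2.2 δ) &&
   ((posTable κ₂).all fun b => (wedges κ₁).all fun e => ptEdgeB (shiftPt δ b.2) e.2.2 (0, 0)) &&
   ((wedges κ₁).all fun e => (wedges κ₂).all fun e' => edgeEdgeB e.2.2 e'.2.2 δ &&
     !(decide (e.1 = reRef Δ e'.1) && decide (e.2.1 = reRef Δ e'.2.1)) &&
     !(decide (e.1 = reRef Δ e'.2.1) && decide (e.2.1 = reRef Δ e'.1))))

/-- **Agreement of foreign end points**: a foreign vertex of one kind that refers to an own vertex of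
the other sits at that vertex's position. [folklore] -/
def phantomOKB (κ₁ κ₂ : Kind) (Δ : ℤ × ℤ) : Bool :=
  let δ := shiftOf Δ
  ((phantoms κ₂).all fun b => match (verts κ₁).lookup (reRef Δ b.1) with
    | some p => decide (shiftPt δ b.2 = p) | none => true) &&
  ((phantoms κ₁).all fun a => match ((verts κ₂).map fun b => (reRef Δ b.1, b.2)).lookup a.1 with
    | some p => decide (a.2 = shiftPt δ p) | none => true)

end Kind

/-! ### The realisability filter -/

/-- **Two kinds may be anchored at tiles at offset `Δ`** (the second `Δ.1` rows below and `Δ.2`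
columns east of the first) in the drawing of some formula — a decidable over-approximation, proved
sound in `GridSAWFormulaDrawing.lean`. [folklore] -/
def mayCooccur (κ₁ κ₂ : Kind) (Δ : ℤ × ℤ) : Bool :=
  -- row classes
  !(decide (Δ.1 = 0) && !decide (κ₁.rowClass = κ₂.rowClass)) &&
  !(decide (Δ.1 = 1) && !decide (κ₁.rowClass = .tile)) &&
  !(decide (Δ.1 = -1) && !decide (κ₂.rowClass = .tile)) &&
  -- the same tile
  !(decide (Δ = (0, 0)) && !(κ₁.tk.compat κ₂.tk)) &&
  !(decide (Δ = (0, 0)) && decide (κ₁.cellPos.isSome ∧ κ₁.cellPos = κ₂.cellPos)) &&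
  !(decide (Δ = (0, 0)) && decide (κ₁.connQ.isSome ∧ κ₁.connQ = κ₂.connQ)) &&
  !(decide (Δ = (0, 0)) && decide (κ₁.family.isSome ∧ κ₁.family = κ₂.family)) &&
  !(decide (Δ = (0, 0)) && decide (κ₁.landSlot.isSome ∧ κ₂.landSlot.isSome ∧ κ₁.landSlot ≠ κ₂.landSlot)) &&
  !(decide (Δ = (0, 0)) && κ₁.isRow && κ₂.c0noRowIn) &&
  !(decide (Δ = (0, 0)) && κ₂.isRow && κ₁.c0noRowIn) &&
  -- row chords and the west neighbour's row-out slot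
  !(decide (Δ = (0, -1)) && κ₁.isRow && κ₂.c2noRowOut) &&
  !(decide (Δ = (0, 1)) && κ₂.isRow && κ₁.c2noRowOut) &&
  -- column and landing cables and the tile above
  !(decide (Δ = (-1, 0)) && decide (∃ s, κ₁.src = some s ∧ ¬ s.compat κ₂.tk)) &&
  !(decide (Δ = (1, 0)) && decide (∃ s, κ₂.src = some s ∧ ¬ s.compat κ₁.tk)) &&
  -- OR-gadget heads
  !(decide (Δ = (0, 1) ∨ Δ = (0, 2)) && κ₁.isOr3 && κ₂.isHead) &&
  !(decide (Δ = (0, -1) ∨ Δ = (0, -2)) && κ₂.isOr3 && κ₁.isHead)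

/-- The near tile offsets. [folklore] -/
def nearOffsets : List (ℤ × ℤ) :=
  [(-1, -2), (-1, -1), (-1, 0), (-1, 1), (-1, 2), (0, -2), (0, -1), (0, 0), (0, 1), (0, 2),
    (1, -2), (1, -1), (1, 0), (1, 1), (1, 2)]

/-- Membership in `nearOffsets` from the bounds. [folklore] -/
theorem mem_nearOffsets_of {a b : ℤ} (ha : -1 ≤ a) (ha' : a ≤ 1) (hb : -2 ≤ b) (hb' : b ≤ 2) : (a, b) ∈ nearOffsets := by
  interval_cases a <;> interval_cases b <;> decide

/-! ### The decided checks -/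

set_option maxHeartbeats 4000000 in
/-- **Every edge of every kind is well formed.** [folklore] -/
theorem edgesWF_all (κ : Kind) : κ.edgesWF = true := by
  cases κ <;> decide +kernel

set_option maxHeartbeats 4000000 in
/-- **Every kind passes the local congestion check.** [folklore] -/
theorem localOK_all (κ : Kind) : κ.localOK = true := by
  cases κ <;> decide +kernel

set_option maxHeartbeats 4000000 in
/-- **Foreign end points agree** for all realisable pairs at all near offsets. [folklore] -/
theorem phantomOK_all (κ₁ : Kind) :
    (Kind.all.all fun κ₂ => nearOffsets.all fun Δ => !mayCooccur κ₁ κ₂ Δ || Kind.phantomOKB κ₁ κ₂ Δ) = true := by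
  cases κ₁ <;> decide +kernel

/-- **The compatibility check of one kind against all kinds at all near offsets** (a kind with
itself at offset `0` excluded; unrealisable pairs filtered by `mayCooccur`). Decided per kind in
`GridSAWFormulaStampCompatA/B.lean`. [folklore] -/
def Kind.compatAll (κ₁ : Kind) : Bool :=
  Kind.all.all fun κ₂ => nearOffsets.all fun Δ =>
    (decide (κ₁ = κ₂) && decide (Δ = (0, 0))) || !mayCooccur κ₁ κ₂ Δ || Kind.compatB κ₁ κ₂ Δ

end Literature.Barriers.CriticalPhenomena.GridSAW.FormulaDrawing
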